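import Mathlib
import Summits.Parity.BatemanHorn.Theorems.IsogenyRedeiSplitBlockJacobiExpectedPartLargeSieve
import Summits.Parity.BatemanHorn.Theorems.IsogenyRedeiSplitBlockJacobiExpectedPartWindows
import HarnessLib

/-!
# Route `IsogenyRedei`, crux `SplitBlockJacobi` (stmt-Parity-11583), line `cofactor-root-discrepancy`:
# the expected part is `o(x)` (`stub_expectedPart`)

The EXPECTED part of the line,
`E_θ(x) = Σ_{(Q,Q′) ∈ P_θ(x)} (Q|Q′) · 4x/(QQ′)`, `P_θ(x)` = prime pairs `Q ≡ Q′ ≡ 1 (mod 4)`,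
`x^θ < Q < Q′`, `QQ′ ≤ x² + 1`, satisfies `E_θ(x) = o(x)` for every `1/2 < θ < 1`.

Proof.  Put `L = ⌊log₂ x⌋`, `m = ⌊log₂ (L+1)⌋`, `K = 3(m+1)` (so `2^K > (L+1)³` and, for
`L ≥ 127`, `4K ≤ L + 1`).  A pair is FAR when `⌊log₂ Q′⌋ ≥ ⌊log₂ Q⌋ + 2K + 1` and
`2^{⌊log₂ Q⌋ + ⌊log₂ Q′⌋ + 2} ≤ x² + 1`.
* The far pairs are exactly the union of the full dyadic boxes `B_i(θ) × B_j` over the admissible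
  scales `(i, j)` (`farSum_eq_sum_boxes`); each box contributes `≤ 16x/2^K` by the large sieve
  (`abs_boxSum_jacobiSym_le`, file `…ExpectedPartLargeSieve`), and there are `≤ 2(L+1)²` boxes:
  far part `≤ 32x/(L+1)` (`abs_farSum_le`).
* The near pairs lie in two Mertens windows per `Q` (`abs_nearSum_le`, file
  `…ExpectedPartWindows`): near part `≤ 12x(((2K+1) log 2 + 16)/(θ log x) + (log 4 + 16)/log(x/4))`.
* `K = O(log log x)`, so everything is `O(x log log x / log x) = o(x)` (`stub_expectedPart`,
  via `Real.isLittleO_log_id_atTop`).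

No new definitions; everything is proved (no named facts).
-/

/- LOG (worker stub_expectedPart, line cofactor-root-discrepancy, crux stmt-Parity-11583)
proved (lean check rc0, 0 warnings, axioms standard) — all three files:
* A work/stubs/ExpectedPartLargeSieve.lean -> Theorems/IsogenyRedeiSplitBlockJacobiExpectedPartLargeSieve.lean
* B work/stubs/ExpectedPartWindows.lean     -> Theorems/IsogenyRedeiSplitBlockJacobiExpectedPartWindows.lean
* C this file (needs A, B accepted)          -> Theorems/IsogenyRedeiSplitBlockJacobiExpectedPart.lean
landed: A = p81147 ACCEPTED (commit dc44196b67ed), B = p81185 ACCEPTED (commit a88b6002e69a);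
C = this file, proposed after A, B.  remaining: nothing to prove. -/

noncomputable section

open Finset Filter
open scoped NumberTheorySymbols

namespace Summit.Parity.BatemanHorn.Cruxes.SplitBlockJacobi.CofactorRootDiscrepancy

/-! ### The far part: decomposition into full dyadic boxes -/

/-- `x^θ < Q` with `θ > 1/2` and `x ≥ 1` forces `x < Q²`
(adapted from `SplitMassMiddlePrime.DigitReparam.lt_sq_of_rpow_lt`). [folklore] -/
theorem nat_lt_sq_of_rpow_lt {x Q : ℕ} {θ : ℝ} (hθ : 1 / 2 < θ) (hx : 1 ≤ x)
    (hQ : (x : ℝ) ^ θ < Q) : x < Q ^ 2 := by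
  have hx1 : (1 : ℝ) ≤ x := by exact_mod_cast hx
  have h0 : (0 : ℝ) ≤ (x : ℝ) ^ θ := Real.rpow_nonneg (by linarith) θ
  have h1 : (x : ℝ) ≤ (x : ℝ) ^ θ * (x : ℝ) ^ θ := by
    rw [← Real.rpow_add (by linarith)]
    have h := Real.rpow_le_rpow_of_exponent_le hx1 (show (1 : ℝ) ≤ θ + θ by linarith)
    rwa [Real.rpow_one] at h
  have h2 : (x : ℝ) ^ θ * (x : ℝ) ^ θ < (Q : ℝ) * Q := mul_lt_mul'' hQ hQ h0 h0
  exact_mod_cast (show (x : ℝ) < (Q : ℝ) ^ 2 by nlinarith)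

/-- **The far pairs are a disjoint union of full dyadic boxes.**  For `1/2 < θ`, `x ≥ 1` and any
`K`, summing any `f` over the far pairs of `P_θ(x)` is the same as summing it over the boxes
`B_i(θ) × B_j`, `B_k = {n prime, n ≡ 1 (4), ⌊log₂ n⌋ = k}`, `B_i(θ) = B_i ∩ (x^θ, ∞)`, over the
admissible scales `i ≤ L`, `j ≤ 2L + 1` (`L = ⌊log₂ x⌋`) with `i + 2K + 1 ≤ j`,
`2^{i+j+2} ≤ x² + 1`, `x < 2^{2i+2}`: inside such a box `Q < 2^{i+1} ≤ 2^j ≤ Q′` and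
`QQ′ < 2^{i+j+2} ≤ x² + 1` automatically. [folklore] -/
theorem farSum_eq_sum_boxes {θ : ℝ} (hθ : 1 / 2 < θ) {x : ℕ} (hx : 1 ≤ x) (K : ℕ)
    (f : ℕ × ℕ → ℝ) :
    ∑ q ∈ ((Finset.range (x ^ 2 + 2) ×ˢ Finset.range (x ^ 2 + 2)).filter (fun q : ℕ × ℕ =>
        q.1.Prime ∧ q.2.Prime ∧ q.1 % 4 = 1 ∧ q.2 % 4 = 1 ∧ (x : ℝ) ^ θ < (q.1 : ℝ) ∧ q.1 < q.2 ∧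
          q.1 * q.2 ≤ x ^ 2 + 1)).filter (fun q : ℕ × ℕ =>
        Nat.log 2 q.1 + 2 * K + 1 ≤ Nat.log 2 q.2 ∧
          2 ^ (Nat.log 2 q.1 + Nat.log 2 q.2 + 2) ≤ x ^ 2 + 1), f q =
    ∑ b ∈ (Finset.range (Nat.log 2 x + 1) ×ˢ Finset.range (2 * Nat.log 2 x + 2)).filter
        (fun b : ℕ × ℕ => b.1 + 2 * K + 1 ≤ b.2 ∧ 2 ^ (b.1 + b.2 + 2) ≤ x ^ 2 + 1 ∧
          x < 2 ^ (2 * b.1 + 2)),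
      ∑ q ∈ ((Finset.range (2 ^ (b.1 + 1))).filter (fun n : ℕ =>
          n.Prime ∧ n % 4 = 1 ∧ Nat.log 2 n = b.1 ∧ (x : ℝ) ^ θ < (n : ℝ))) ×ˢ
        ((Finset.range (2 ^ (b.2 + 1))).filter (fun n : ℕ =>
          n.Prime ∧ n % 4 = 1 ∧ Nat.log 2 n = b.2)), f q := by
  set L := Nat.log 2 x with hL
  have hxL : x < 2 ^ (L + 1) := Nat.lt_pow_succ_log_self one_lt_two x
  have hx2L : x ^ 2 + 1 < 2 ^ (2 * L + 2) := by
    have h1 : x + 1 ≤ 2 ^ (L + 1) := hxL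
    have h2 : (x + 1) ^ 2 ≤ (2 ^ (L + 1)) ^ 2 := Nat.pow_le_pow_left h1 2
    have h3 : (2 ^ (L + 1)) ^ 2 = 2 ^ (2 * L + 2) := by rw [← pow_mul]; ring_nf
    nlinarith
  -- the scale map lands in the admissible index set
  have hmaps : ∀ q ∈ ((Finset.range (x ^ 2 + 2) ×ˢ Finset.range (x ^ 2 + 2)).filter
      (fun q : ℕ × ℕ => q.1.Prime ∧ q.2.Prime ∧ q.1 % 4 = 1 ∧ q.2 % 4 = 1 ∧
        (x : ℝ) ^ θ < (q.1 : ℝ) ∧ q.1 < q.2 ∧ q.1 * q.2 ≤ x ^ 2 + 1)).filter (fun q : ℕ × ℕ =>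
        Nat.log 2 q.1 + 2 * K + 1 ≤ Nat.log 2 q.2 ∧
          2 ^ (Nat.log 2 q.1 + Nat.log 2 q.2 + 2) ≤ x ^ 2 + 1),
      (Nat.log 2 q.1, Nat.log 2 q.2) ∈
        (Finset.range (L + 1) ×ˢ Finset.range (2 * L + 2)).filter
          (fun b : ℕ × ℕ => b.1 + 2 * K + 1 ≤ b.2 ∧ 2 ^ (b.1 + b.2 + 2) ≤ x ^ 2 + 1 ∧
            x < 2 ^ (2 * b.1 + 2)) := by
    intro q hq
    simp only [mem_filter, mem_product, mem_range] at hq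
    obtain ⟨⟨-, hp1, hp2, -, -, hθlt, hlt, hprod⟩, hfar1, hfar2⟩ := hq
    simp only [mem_filter, mem_product, mem_range]
    have hQx : q.1 ≤ x := by
      have h1 : q.1 * q.1 < q.1 * q.2 := Nat.mul_lt_mul_of_pos_left hlt hp1.pos
      have h2 : q.1 * q.1 ≤ x * x := by nlinarith
      exact Nat.mul_self_le_mul_self_iff.mp h2
    have hQ'x : q.2 ≤ x ^ 2 + 1 := le_trans (Nat.le_mul_of_pos_left _ hp1.pos) hprod
    refine ⟨⟨?_, ?_⟩, hfar1, hfar2, ?_⟩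
    · exact Nat.lt_succ_of_le (Nat.log_mono_right hQx)
    · exact Nat.log_lt_of_lt_pow' (by omega) (lt_of_le_of_lt hQ'x hx2L)
    · have h1 : x < q.1 ^ 2 := nat_lt_sq_of_rpow_lt hθ hx hθlt
      have h2 : q.1 < 2 ^ (Nat.log 2 q.1 + 1) := Nat.lt_pow_succ_log_self one_lt_two _
      have h3 : q.1 ^ 2 < (2 ^ (Nat.log 2 q.1 + 1)) ^ 2 := Nat.pow_lt_pow_left h2 two_ne_zero
      have h4 : (2 ^ (Nat.log 2 q.1 + 1)) ^ 2 = 2 ^ (2 * Nat.log 2 q.1 + 2) := by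
        rw [← pow_mul]; ring_nf
      omega
  rw [← sum_fiberwise_of_maps_to hmaps]
  refine sum_congr rfl ?_
  rintro ⟨i, j⟩ hb
  refine sum_congr ?_ fun _ _ => rfl
  simp only [mem_filter, mem_product, mem_range] at hb
  obtain ⟨⟨-, -⟩, hb1, hb2, -⟩ := hb
  ext q
  simp only [mem_filter, mem_product, mem_range, Prod.mk.injEq]
  constructor
  · rintro ⟨⟨⟨⟨-, -⟩, hp1, hp2, hm1, hm2, hθlt, -, -⟩, -, -⟩, hg1, hg2⟩
    refine ⟨⟨?_, hp1, hm1, hg1, hθlt⟩, ?_, hp2, hm2, hg2⟩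
    · rw [← hg1]; exact Nat.lt_pow_succ_log_self one_lt_two _
    · rw [← hg2]; exact Nat.lt_pow_succ_log_self one_lt_two _
  · rintro ⟨⟨hr1, hp1, hm1, hg1, hθlt⟩, hr2, hp2, hm2, hg2⟩
    have hi : 2 ^ i ≤ q.1 := by rw [← hg1]; exact Nat.pow_log_le_self 2 hp1.ne_zero
    have hj : 2 ^ j ≤ q.2 := by rw [← hg2]; exact Nat.pow_log_le_self 2 hp2.ne_zero
    have hij : 2 ^ (i + 1) ≤ 2 ^ j := Nat.pow_le_pow_right (by norm_num) (by omega)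
    have hlt : q.1 < q.2 := lt_of_lt_of_le hr1 (hij.trans hj)
    have hprod : q.1 * q.2 ≤ x ^ 2 + 1 := by
      have h1 : q.1 * q.2 < 2 ^ (i + 1) * 2 ^ (j + 1) :=
        Nat.mul_lt_mul'' hr1 hr2
      have h2 : 2 ^ (i + 1) * 2 ^ (j + 1) = 2 ^ (i + j + 2) := by
        rw [← pow_add]; ring_nf
      omega
    have hq2 : q.2 < x ^ 2 + 2 := by
      have h1 : 2 ^ (j + 1) ≤ 2 ^ (i + j + 2) := Nat.pow_le_pow_right (by norm_num) (by omega)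
      omega
    refine ⟨⟨⟨⟨by omega, hq2⟩, hp1, hp2, hm1, hm2, hθlt, hlt, hprod⟩, ?_, ?_⟩, hg1, hg2⟩
    · rw [hg1, hg2]; exact hb1
    · rw [hg1, hg2]; exact hb2

/-- `12(m+1) ≤ 2^m` for `m ≥ 7`. [folklore] -/
theorem twelve_mul_succ_le_two_pow {m : ℕ} (hm : 7 ≤ m) : 12 * (m + 1) ≤ 2 ^ m := by
  induction m, hm using Nat.le_induction with
  | base => norm_num
  | succ n hn ih => rw [pow_succ]; omega

/-- **The far part.**  With `L = ⌊log₂ x⌋ ≥ 127`, `m = ⌊log₂(L+1)⌋`, `K = 3(m+1)`: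
`|Σ_{far pairs} (Q|Q′) · 4x/(QQ′)| ≤ 32x/(L+1)`.  Indeed `4K ≤ L + 1` (as `12(m+1) ≤ 2^m ≤ L+1`),
so every admissible box has `2K ≤ i + 1` and contributes `≤ 16x/2^K` (`abs_boxSum_jacobiSym_le`);
there are `≤ 2(L+1)²` boxes and `2^K = (2^{m+1})³ > (L+1)³`. [folklore] -/
theorem abs_farSum_le {θ : ℝ} (hθ : 1 / 2 < θ) {x : ℕ} (hx : 1 ≤ x) (hL : 127 ≤ Nat.log 2 x) :
    |∑ q ∈ ((Finset.range (x ^ 2 + 2) ×ˢ Finset.range (x ^ 2 + 2)).filter (fun q : ℕ × ℕ =>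
        q.1.Prime ∧ q.2.Prime ∧ q.1 % 4 = 1 ∧ q.2 % 4 = 1 ∧ (x : ℝ) ^ θ < (q.1 : ℝ) ∧ q.1 < q.2 ∧
          q.1 * q.2 ≤ x ^ 2 + 1)).filter (fun q : ℕ × ℕ =>
        Nat.log 2 q.1 + 2 * (3 * (Nat.log 2 (Nat.log 2 x + 1) + 1)) + 1 ≤ Nat.log 2 q.2 ∧
          2 ^ (Nat.log 2 q.1 + Nat.log 2 q.2 + 2) ≤ x ^ 2 + 1),
      (jacobiSym (q.1 : ℤ) q.2 : ℝ) * (4 * (x : ℝ) / ((q.1 * q.2 : ℕ) : ℝ))| ≤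
      32 * (x : ℝ) / (Nat.log 2 x + 1) := by
  set L := Nat.log 2 x with hLdef
  set m := Nat.log 2 (L + 1) with hmdef
  set K := 3 * (m + 1) with hKdef
  -- `4K ≤ L + 1`
  have hm7 : 7 ≤ m := Nat.le_log_of_pow_le one_lt_two (by omega)
  have h2m : 2 ^ m ≤ L + 1 := Nat.pow_log_le_self 2 (by omega)
  have h4K : 4 * K ≤ L + 1 := by
    have := twelve_mul_succ_le_two_pow hm7
    omega
  -- `(L+1)^3 < 2^K`
  have hLK : ((L : ℝ) + 1) ^ 3 < (2 : ℝ) ^ K := by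
    have h1 : L + 1 < 2 ^ (m + 1) := Nat.lt_pow_succ_log_self one_lt_two _
    have h2 : (L + 1) ^ 3 < (2 ^ (m + 1)) ^ 3 := Nat.pow_lt_pow_left h1 (by norm_num)
    have h3 : (2 ^ (m + 1)) ^ 3 = 2 ^ K := by rw [hKdef, ← pow_mul]; ring_nf
    rw [h3] at h2
    exact_mod_cast h2
  rw [farSum_eq_sum_boxes hθ hx K]
  refine (abs_sum_le_sum_abs _ _).trans ?_
  -- each box contributes at most `16x/2^K`
  have hbox : ∀ b ∈ (Finset.range (L + 1) ×ˢ Finset.range (2 * L + 2)).filter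
      (fun b : ℕ × ℕ => b.1 + 2 * K + 1 ≤ b.2 ∧ 2 ^ (b.1 + b.2 + 2) ≤ x ^ 2 + 1 ∧
        x < 2 ^ (2 * b.1 + 2)),
      |∑ q ∈ ((Finset.range (2 ^ (b.1 + 1))).filter (fun n : ℕ =>
          n.Prime ∧ n % 4 = 1 ∧ Nat.log 2 n = b.1 ∧ (x : ℝ) ^ θ < (n : ℝ))) ×ˢ
        ((Finset.range (2 ^ (b.2 + 1))).filter (fun n : ℕ =>
          n.Prime ∧ n % 4 = 1 ∧ Nat.log 2 n = b.2)),
        (jacobiSym (q.1 : ℤ) q.2 : ℝ) * (4 * (x : ℝ) / ((q.1 * q.2 : ℕ) : ℝ))| ≤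
        16 * (x : ℝ) / 2 ^ K := by
    intro b hb
    simp only [mem_filter, mem_product, mem_range] at hb
    obtain ⟨⟨-, -⟩, hb1, -, hb3⟩ := hb
    have hLi : L < 2 * b.1 + 2 := Nat.log_lt_of_lt_pow' (by omega) hb3
    refine abs_boxSum_jacobiSym_le x b.1 b.2 K _ _ ?_ ?_ (by omega) hb1
    · intro Q hQ
      simp only [mem_filter, mem_range] at hQ
      obtain ⟨hr, hp, hm4, hg, -⟩ := hQ
      exact ⟨hp, hm4, by rw [← hg]; exact Nat.pow_log_le_self 2 hp.ne_zero, hr⟩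
    · intro n hn
      simp only [mem_filter, mem_range] at hn
      obtain ⟨hr, hp, hm4, hg⟩ := hn
      exact ⟨Nat.odd_iff.mpr (by omega), by rw [← hg]; exact Nat.pow_log_le_self 2 hp.ne_zero, hr⟩
  refine (sum_le_card_nsmul _ _ _ hbox).trans ?_
  rw [nsmul_eq_mul]
  have hcard : (#((Finset.range (L + 1) ×ˢ Finset.range (2 * L + 2)).filter
      (fun b : ℕ × ℕ => b.1 + 2 * K + 1 ≤ b.2 ∧ 2 ^ (b.1 + b.2 + 2) ≤ x ^ 2 + 1 ∧
        x < 2 ^ (2 * b.1 + 2))) : ℝ) ≤ 2 * ((L : ℝ) + 1) ^ 2 := by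
    refine le_trans (b := ((#(Finset.range (L + 1) ×ˢ Finset.range (2 * L + 2)) : ℕ) : ℝ))
      (by exact_mod_cast card_filter_le _ _) (le_of_eq ?_)
    rw [card_product, card_range, card_range]
    push_cast
    ring
  have hx0 : (0 : ℝ) ≤ x := Nat.cast_nonneg x
  calc _ ≤ 2 * ((L : ℝ) + 1) ^ 2 * (16 * (x : ℝ) / 2 ^ K) :=
        mul_le_mul_of_nonneg_right hcard (by positivity)
    _ = 32 * (x : ℝ) * ((L : ℝ) + 1) ^ 2 / 2 ^ K := by ring
    _ ≤ 32 * (x : ℝ) * ((L : ℝ) + 1) ^ 2 / ((L : ℝ) + 1) ^ 3 :=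
        div_le_div_of_nonneg_left (by positivity) (by positivity) hLK.le
    _ = 32 * (x : ℝ) / ((L : ℝ) + 1) := by field_simp

/-! ### Assembly -/

/-- **The quantitative bound.**  For `1/2 < θ < 1`, `x ≥ 8`, `x^θ ≥ 2`, `log x ≥ 24` and
`L = ⌊log₂ x⌋ ≥ 127` (with `m = ⌊log₂(L+1)⌋`):
`|E_θ(x)| ≤ x · (32/(L+1) + 12·(((6m+7) log 2 + 16)/(θ log x) + (log 4 + 16)/log(x/4)))`
(far part `abs_farSum_le` + near part `abs_nearSum_le` with `K = 3(m+1)`). [folklore] -/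
theorem abs_expectedPart_le {θ : ℝ} (hθ : 1 / 2 < θ) (hθ1 : θ < 1) {x : ℕ} (hx : 8 ≤ x)
    (hxθ : 2 ≤ (x : ℝ) ^ θ) (hlog : 24 ≤ Real.log x) (hL : 127 ≤ Nat.log 2 x) :
    |∑ q ∈ (Finset.range (x ^ 2 + 2) ×ˢ Finset.range (x ^ 2 + 2)).filter (fun q : ℕ × ℕ =>
        q.1.Prime ∧ q.2.Prime ∧ q.1 % 4 = 1 ∧ q.2 % 4 = 1 ∧ (x : ℝ) ^ θ < (q.1 : ℝ) ∧ q.1 < q.2 ∧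
          q.1 * q.2 ≤ x ^ 2 + 1),
      (jacobiSym (q.1 : ℤ) q.2 : ℝ) * (4 * (x : ℝ) / ((q.1 * q.2 : ℕ) : ℝ))| ≤
      (x : ℝ) * (32 / (Nat.log 2 x + 1) +
        12 * ((((6 * Nat.log 2 (Nat.log 2 x + 1) + 7 : ℕ) : ℝ) * Real.log 2 + 16) /
          (θ * Real.log x) + (Real.log 4 + 16) / Real.log (x / 4))) := by
  set L := Nat.log 2 x with hLdef
  set m := Nat.log 2 (L + 1) with hmdef
  set K := 3 * (m + 1) with hKdef
  have hx1 : 1 ≤ x := le_trans (by norm_num) hx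
  have hfar := abs_farSum_le hθ hx1 hL
  rw [← sum_filter_add_sum_filter_not _ (fun q : ℕ × ℕ =>
    Nat.log 2 q.1 + 2 * K + 1 ≤ Nat.log 2 q.2 ∧ 2 ^ (Nat.log 2 q.1 + Nat.log 2 q.2 + 2) ≤ x ^ 2 + 1)]
  have hnear := abs_nearSum_le θ hθ hθ1 x K hx hxθ hlog
    (((Finset.range (x ^ 2 + 2) ×ˢ Finset.range (x ^ 2 + 2)).filter (fun q : ℕ × ℕ =>
        q.1.Prime ∧ q.2.Prime ∧ q.1 % 4 = 1 ∧ q.2 % 4 = 1 ∧ (x : ℝ) ^ θ < (q.1 : ℝ) ∧ q.1 < q.2 ∧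
          q.1 * q.2 ≤ x ^ 2 + 1)).filter (fun q : ℕ × ℕ =>
        ¬ (Nat.log 2 q.1 + 2 * K + 1 ≤ Nat.log 2 q.2 ∧
          2 ^ (Nat.log 2 q.1 + Nat.log 2 q.2 + 2) ≤ x ^ 2 + 1))) (by
      intro q hq
      simp only [mem_filter, mem_product, mem_range] at hq
      obtain ⟨⟨-, hp1, hp2, -, -, hθlt, hlt, hprod⟩, hnf⟩ := hq
      exact ⟨hp1, hp2, hθlt, hlt, hprod, hnf⟩)
  have hK2 : ((2 * K + 1 : ℕ) : ℝ) = ((6 * m + 7 : ℕ) : ℝ) := by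
    rw [hKdef]; push_cast; ring
  rw [hK2] at hnear
  refine (abs_add_le _ _).trans ((add_le_add hfar hnear).trans_eq ?_)
  ring

/-- `loglog`-type growth: for `c > 0` and any `d`, eventually `6 log u + d ≤ c u`. [folklore] -/
theorem eventually_six_log_add_le {c : ℝ} (hc : 0 < c) (d : ℝ) :
    ∀ᶠ u : ℝ in atTop, 6 * Real.log u + d ≤ c * u := by
  have h := Real.isLittleO_log_id_atTop
  rw [Asymptotics.isLittleO_iff] at h
  have h1 : ∀ᶠ u : ℝ in atTop, ‖Real.log u‖ ≤ c / 12 * ‖(id u : ℝ)‖ := h (by positivity)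
  filter_upwards [h1, eventually_ge_atTop (0 : ℝ), eventually_ge_atTop (2 * |d| / c)]
    with u hu hu0 hud
  rw [id, Real.norm_eq_abs, Real.norm_eq_abs, abs_of_nonneg hu0] at hu
  have h2 : Real.log u ≤ c / 12 * u := (le_abs_self _).trans hu
  have h3 : |d| ≤ c / 2 * u := by
    rw [div_le_iff₀ hc] at hud
    linarith
  linarith [le_abs_self d]

/-- **`stub_expectedPart`** of the line skeleton `cofactor-root-discrepancy` (crux
`IsogenyRedei.SplitBlockJacobi`, stmt-Parity-11583): the EXPECTED part
`E_θ(x) = Σ_{(Q,Q′) ∈ P_θ(x)} (Q|Q′) · 4x/(QQ′)` of the pair-side decomposition is `o(x)` for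
every `1/2 < θ < 1`: for every `ε > 0`, eventually `|E_θ(x)| ≤ εx`.  Multiplicative large sieve on
the far dyadic boxes + Mertens windows on the near pairs (`abs_expectedPart_le`), then
`log log x / log x → 0`. [folklore] -/
theorem stub_expectedPart :
    ∀ θ : ℝ, 1 / 2 < θ → θ < 1 → ∀ ε : ℝ, 0 < ε → ∀ᶠ x : ℕ in Filter.atTop,
      |∑ q ∈ (Finset.range (x ^ 2 + 2) ×ˢ Finset.range (x ^ 2 + 2)).filter (fun q : ℕ × ℕ =>
          q.1.Prime ∧ q.2.Prime ∧ q.1 % 4 = 1 ∧ q.2 % 4 = 1 ∧ (x : ℝ) ^ θ < (q.1 : ℝ) ∧ q.1 < q.2 ∧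
            q.1 * q.2 ≤ x ^ 2 + 1),
        (jacobiSym (q.1 : ℤ) q.2 : ℝ) * (4 * (x : ℝ) / ((q.1 * q.2 : ℕ) : ℝ))| ≤ ε * x := by
  intro θ hθ hθ1 ε hε
  have hθ0 : 0 < θ := by linarith
  have hlog2 := Real.log_two_gt_d9
  have hlog2' := Real.log_two_lt_d9
  -- the real-variable conditions, pulled back along `u = log x → ∞`
  have hreal : ∀ᶠ u : ℝ in atTop, 96 / ε ≤ u ∧ 6 * Real.log u + 30 ≤ ε * θ / 36 * u ∧
      648 / ε + 2 ≤ u ∧ 1 ≤ u :=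
    (eventually_ge_atTop _).and ((eventually_six_log_add_le (by positivity) 30).and
      ((eventually_ge_atTop _).and (eventually_ge_atTop _)))
  have hT : Tendsto (fun x : ℕ => Real.log (x : ℝ)) atTop atTop :=
    Real.tendsto_log_atTop.comp tendsto_natCast_atTop_atTop
  filter_upwards [hT.eventually hreal, eventually_ge_atTop (2 ^ 127)] with x hu hx
  obtain ⟨hu1, hu2, hu3, hu4⟩ := hu
  set u : ℝ := Real.log (x : ℝ) with hudef
  set L := Nat.log 2 x with hLdef
  set m := Nat.log 2 (L + 1) with hmdef
  -- the hypotheses of the quantitative bound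
  have hx8 : 8 ≤ x := le_trans (by norm_num) hx
  have hx0 : (0 : ℝ) < x := by exact_mod_cast (lt_of_lt_of_le (by norm_num) hx8)
  have hxR : (2 : ℝ) ^ 127 ≤ x := by exact_mod_cast hx
  have hL : 127 ≤ L := Nat.le_log_of_pow_le one_lt_two (by omega)
  have hlogx : 127 * Real.log 2 ≤ u := by
    have e : (127 : ℝ) * Real.log 2 = Real.log ((2 : ℝ) ^ 127) := by
      rw [Real.log_pow]; ring
    rw [hudef, e]
    exact Real.log_le_log (by positivity) hxR
  have hlog24 : 24 ≤ u := by nlinarith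
  have hxθ : 2 ≤ (x : ℝ) ^ θ := by
    have h1 : ((2 : ℝ) ^ 127) ^ θ ≤ (x : ℝ) ^ θ := Real.rpow_le_rpow (by positivity) hxR hθ0.le
    have h2 : (2 : ℝ) ≤ ((2 : ℝ) ^ 127) ^ θ := by
      rw [← Real.rpow_natCast, ← Real.rpow_mul (by norm_num)]
      have h := Real.rpow_le_rpow_of_exponent_le (show (1 : ℝ) ≤ 2 by norm_num)
        (show (1 : ℝ) ≤ (127 : ℕ) * θ by push_cast; nlinarith)
      rwa [Real.rpow_one] at h
    exact h2.trans h1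
  have hmain := abs_expectedPart_le hθ hθ1 hx8 hxθ hlog24 hL
  refine hmain.trans ?_
  -- (p1) far part
  have huL : u ≤ (L : ℝ) + 1 := by
    have h1 : x < 2 ^ (L + 1) := Nat.lt_pow_succ_log_self one_lt_two x
    have h2 : (x : ℝ) < (2 : ℝ) ^ (L + 1) := by exact_mod_cast h1
    have h3 : u < ((L : ℝ) + 1) * Real.log 2 := by
      rw [hudef, ← Nat.cast_add_one, ← Real.log_pow]
      exact Real.log_lt_log hx0 (by exact_mod_cast h2)
    have hL0 : (0 : ℝ) ≤ (L : ℝ) + 1 := by positivity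
    nlinarith
  have hu0 : 0 < u := by linarith
  have hp1 : 32 / ((L : ℝ) + 1) ≤ ε / 3 := by
    calc 32 / ((L : ℝ) + 1) ≤ 32 / u := div_le_div_of_nonneg_left (by norm_num) hu0 huL
      _ ≤ ε / 3 := by
          rw [div_le_iff₀ hu0]
          rw [div_le_iff₀ hε] at hu1
          linarith
  -- (p2) near window (a): `(6m+7) log 2 + 16 ≤ 6 log u + 30`
  have hm : (m : ℝ) * Real.log 2 ≤ Real.log ((L : ℝ) + 1) := by
    have h1 : 2 ^ m ≤ L + 1 := Nat.pow_log_le_self 2 (by omega)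
    have h2 : (2 : ℝ) ^ m ≤ (L : ℝ) + 1 := by exact_mod_cast h1
    rw [← Real.log_pow]
    exact Real.log_le_log (by positivity) h2
  have hL4u : (L : ℝ) + 1 ≤ 4 * u := by
    have h1 : 2 ^ L ≤ x := Nat.pow_log_le_self 2 (by omega)
    have h2 : (2 : ℝ) ^ L ≤ x := by exact_mod_cast h1
    have h3 : (L : ℝ) * Real.log 2 ≤ u := by
      rw [← Real.log_pow]
      exact Real.log_le_log (by positivity) h2
    nlinarith
  have hlogL : Real.log ((L : ℝ) + 1) ≤ Real.log 4 + Real.log u := by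
    rw [← Real.log_mul (by norm_num) hu0.ne']
    exact Real.log_le_log (by positivity) hL4u
  have hlog4 : Real.log 4 = 2 * Real.log 2 := by
    rw [show (4 : ℝ) = 2 ^ 2 by norm_num, Real.log_pow]; push_cast; ring
  have hNa : ((6 * m + 7 : ℕ) : ℝ) * Real.log 2 + 16 ≤ 6 * Real.log u + 30 := by
    push_cast
    nlinarith
  have hp2 : 12 * ((((6 * m + 7 : ℕ) : ℝ) * Real.log 2 + 16) / (θ * u)) ≤ ε / 3 := by
    have hθu : 0 < θ * u := mul_pos hθ0 hu0
    calc 12 * ((((6 * m + 7 : ℕ) : ℝ) * Real.log 2 + 16) / (θ * u))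
        ≤ 12 * ((6 * Real.log u + 30) / (θ * u)) := by gcongr
      _ ≤ 12 * ((ε * θ / 36 * u) / (θ * u)) := by gcongr
      _ = ε / 3 := by field_simp; ring
  -- (p3) near window (b)
  have hp3 : 12 * ((Real.log 4 + 16) / Real.log (x / 4)) ≤ ε / 3 := by
    have hlx4 : Real.log (x / 4) = u - Real.log 4 := by
      rw [Real.log_div hx0.ne' (by norm_num), hudef]
    rw [hlx4]
    have hden : 648 / ε ≤ u - Real.log 4 := by linarith
    have hden0 : 0 < u - Real.log 4 := lt_of_lt_of_le (by positivity) hden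
    calc 12 * ((Real.log 4 + 16) / (u - Real.log 4)) ≤ 12 * (18 / (u - Real.log 4)) := by
          gcongr; linarith
      _ ≤ ε / 3 := by
          rw [div_le_iff₀ hε] at hden
          rw [← mul_div_assoc, div_le_iff₀ hden0]
          nlinarith
  have hx0' : (0 : ℝ) ≤ x := hx0.le
  rw [hmdef] at hp2
  rw [hLdef] at hp1 hp2
  rw [hudef] at hp2
  calc (x : ℝ) * (32 / (Nat.log 2 x + 1) +
        12 * ((((6 * Nat.log 2 (Nat.log 2 x + 1) + 7 : ℕ) : ℝ) * Real.log 2 + 16) /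
          (θ * Real.log x) + (Real.log 4 + 16) / Real.log (x / 4)))
      = (x : ℝ) * (32 / (Nat.log 2 x + 1) +
          (12 * ((((6 * Nat.log 2 (Nat.log 2 x + 1) + 7 : ℕ) : ℝ) * Real.log 2 + 16) /
            (θ * Real.log x)) + 12 * ((Real.log 4 + 16) / Real.log (x / 4)))) := by ring
    _ ≤ (x : ℝ) * (ε / 3 + (ε / 3 + ε / 3)) := by gcongr
    _ = ε * x := by ring

end Summit.Parity.BatemanHorn.Cruxes.SplitBlockJacobi.CofactorRootDiscrepancy
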